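import Summits.ValiantsHypothesis.ValiantsHypothesis.Theses.ImmanantSlice
import Summits.ValiantsHypothesis.ValiantsHypothesis.Theorems.ImmanantSliceDeterminantalRigidityReductions

/-!
# Line `dc-split` for crux `ImmanantSlice.TwoClassRigidity` (stmt-ValiantsHypothesis-4209)

Strategist line = the typed DECOMPOSITION of the restated deciding crux through affine
determinantal complexity (`dc`), refined one level: the `dc`-rigidity piece is itself cut along
the classical reduction / hardness seam.

* `stub_sliceVBP` — piece 1 of the split (route child `SliceVBP`): `VP = VBP` on Schur's
  class-function slice (VP families of generalized matrix functions of class functions have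
  p-bounded `dc`). Implies neither the crux nor `VP ≠ VNP`; it is the transfer
  `DcPerSuperpolynomial ℂ → ValiantsHypothesis` on the slice.
* `stub_dcTwoClassDominance` — REDUCTION half of piece 2 (route child `DcTwoClassRigidity`):
  a class-function family with p-bounded `dc` that violates sign-likeness on the `≤ 2`-cycle part of
  `Π_k(n)` infinitely often (for every `k`) makes `dc(per_m)` polynomially small for infinitely
  many `m` (gadget/interpolation reductions `per ≤ d_χ` in the style of Curticapean 2021 §1.2,
  Mertens–Moore 2013; i.o. hypothesis ⟹ i.o. conclusion, the honest shape of a reduction).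
* `stub_dcPerHard_ae` — HARDNESS half of piece 2: `dc(per_m)` grows superpolynomially ALMOST
  EVERYWHERE (`∀ c, m^c + c < dc(per_m)` for all large `m`) — the a.e. form of Valiant's
  permanent-versus-determinant conjecture (`DcPerSuperpolynomial ℂ`, stmt-ValiantsHypothesis-0320,
  is its i.o. shadow); `VNP ⊄ VBP`, it does not give `VP ≠ VNP`.

Composition: `dcTwoClassRigidity_of_stubs : stub₂ → stub₃ → DcTwoClassRigidity` (contrapositive)
and `TwoClassRigidity_of : stub₁ → stub₂ → stub₃ → TwoClassRigidity` (piece 1 gives p-bounded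
`dc`; piece 2 gives `c · sgn` on the `≤ 2`-cycle classes; an `n`-cycle and a type-`(a, n-a)`
permutation lie there with opposite signs). Sorries only inside `stub_*`.
-/

noncomputable section

namespace Summit.ValiantsHypothesis.ValiantsHypothesis.Cruxes.TwoClassRigidity.DcSplit

open MvPolynomial Literature.Computability.AlgebraicComplexity
open Summit.ValiantsHypothesis.ValiantsHypothesis.Theses.ImmanantSlice
open Summit.ValiantsHypothesis.Theorems.DeterminantalRigidityReductions

/-- **stub 1 = piece `SliceVBP`.** `VP = VBP` on the class-function slice: every `VP` p-family of
generalized matrix functions of class functions has p-bounded affine determinantal complexity.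
(Open; why it might fail: a VP class-function immanant family of intermediate `dc`, e.g. if
`VP ≠ VBP` is witnessed on the slice; sources: Valiant1979, Burgisser2000 §2.5, Curticapean2021.) -/
theorem stub_sliceVBP :
    ∀ χ : (n : ℕ) → Equiv.Perm (Fin n) → ℂ, (∀ n (σ τ : Equiv.Perm (Fin n)), IsConj σ τ → χ n σ = χ n τ) → Literature.Computability.AlgebraicComplexity.IsVPFamily (fun n => ∑ σ : Equiv.Perm (Fin n), MvPolynomial.C (χ n σ) * ∏ i : Fin n, MvPolynomial.X (σ i, i)) → Literature.Computability.AlgebraicComplexity.IsPBounded (fun n => Literature.Computability.AlgebraicComplexity.determinantalComplexity (∑ σ : Equiv.Perm (Fin n), MvPolynomial.C (χ n σ) * ∏ i : Fin n, MvPolynomial.X (σ i, i))) := by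
  sorry

/-- **stub 2 (dc two-class dominance, i.o. → i.o.).** A class-function family with p-bounded
`dc(d_χ)` that, for every `k`, violates sign-likeness on the `≤ 2`-cycle part of `Π_k(n)` at
infinitely many `n`, makes the permanent `dc`-cheap at infinitely many sizes. (Reduction content of
piece 2; why it might fail: lopsided violations `a ≪ n` may only yield `per_m` with `m ≪ n^ε`, and
Ladner-type intermediate families (Burgisser2000 Ch. 5); sources: Curticapean2021 §1.2,
MertensMoore2013, Valiant1979.) -/
theorem stub_dcTwoClassDominance :
    ∀ χ : (n : ℕ) → Equiv.Perm (Fin n) → ℂ, (∀ n (σ τ : Equiv.Perm (Fin n)), IsConj σ τ → χ n σ = χ n τ) → Literature.Computability.AlgebraicComplexity.IsPBounded (fun n => Literature.Computability.AlgebraicComplexity.determinantalComplexity (∑ σ : Equiv.Perm (Fin n), MvPolynomial.C (χ n σ) * ∏ i : Fin n, MvPolynomial.X (σ i, i))) → (∀ k n₀ : ℕ, ∃ n, n₀ ≤ n ∧ ∀ c : ℂ, ∃ σ : Equiv.Perm (Fin n), (∀ i, σ i ≠ i) ∧ (∀ m ∈ σ.cycleType, k < m) ∧ Multiset.card σ.cycleType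 ≤ 2 ∧ χ n σ ≠ c * ((Equiv.Perm.sign σ : ℤ) : ℂ)) → ∃ c : ℕ, ∀ m₀ : ℕ, ∃ m, m₀ ≤ m ∧ Literature.Computability.AlgebraicComplexity.determinantalComplexity (Literature.Computability.AlgebraicComplexity.perPoly (Fin m) ℂ) ≤ m ^ c + c := by
  sorry

/-- **stub 3 (a.e. superpolynomial `dc` of the permanent).** For every `c`, `m ^ c + c < dc(per_m)`
for all large `m` — the almost-everywhere form of Valiant's permanent-versus-determinant conjecture
(Valiant1979; Landsberg2017 Conj. 1.2.4.2 "dc(perm_m) grows faster than any polynomial"; its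
i.o. shadow is `DcPerSuperpolynomial ℂ` = stmt-ValiantsHypothesis-0320). (Why it might fail: only
as `VNP ⊆ VBP`; known `m²/2 ≤ dc(per_m) ≤ 2^m - 1`, MignonRessayre2004 / Grenet2011.) -/
theorem stub_dcPerHard_ae :
    ∀ c : ℕ, ∃ m₀ : ℕ, ∀ m, m₀ ≤ m → m ^ c + c < Literature.Computability.AlgebraicComplexity.determinantalComplexity (Literature.Computability.AlgebraicComplexity.perPoly (Fin m) ℂ) := by
  sorry

/-- Piece 2 (`DcTwoClassRigidity`) from its reduction and hardness halves: if a `dc`-cheap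
class-function family were not eventually `c · sgn` on the `≤ 2`-cycle part of some `Π_k`, it would
violate sign-likeness there for every `k` infinitely often (negation pushed through the
quantifiers), so `dc(per_m) ≤ m^c + c` infinitely often (stub 2), against stub 3. [folklore] -/
theorem dcTwoClassRigidity_of_stubs
    (hdom : ∀ χ : (n : ℕ) → Equiv.Perm (Fin n) → ℂ, (∀ n (σ τ : Equiv.Perm (Fin n)), IsConj σ τ → χ n σ = χ n τ) → Literature.Computability.AlgebraicComplexity.IsPBounded (fun n => Literature.Computability.AlgebraicComplexity.determinantalComplexity (∑ σ : Equiv.Perm (Fin n), MvPolynomial.C (χ n σ) * ∏ i : Fin n, MvPolynomial.X (σ i, i))) → (∀ k n₀ : ℕ, ∃ n, n₀ ≤ n ∧ ∀ c : ℂ, ∃ σ : Equiv.Perm (Fin n), (∀ i, σ i ≠ i) ∧ (∀ m ∈ σ.cycleType, k < m) ∧ Multiset.card σ.cycleType ≤ 2 ∧ χ n σ ≠ c * ((Equiv.Perm.sign σ : ℤ) : ℂ)) → ∃ c : ℕ, ∀ m₀ : ℕ, ∃ m, m₀ ≤ m ∧ Literature.Computability.AlgebraicComplexity.determinantalComplexity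 (Literature.Computability.AlgebraicComplexity.perPoly (Fin m) ℂ) ≤ m ^ c + c)
    (hhard : ∀ c : ℕ, ∃ m₀ : ℕ, ∀ m, m₀ ≤ m → m ^ c + c < Literature.Computability.AlgebraicComplexity.determinantalComplexity (Literature.Computability.AlgebraicComplexity.perPoly (Fin m) ℂ)) :
    ∀ χ : (n : ℕ) → Equiv.Perm (Fin n) → ℂ, (∀ n (σ τ : Equiv.Perm (Fin n)), IsConj σ τ → χ n σ = χ n τ) → Literature.Computability.AlgebraicComplexity.IsPBounded (fun n => Literature.Computability.AlgebraicComplexity.determinantalComplexity (∑ σ : Equiv.Perm (Fin n), MvPolynomial.C (χ n σ) * ∏ i : Fin n, MvPolynomial.X (σ i, i))) → ∃ k n₀ : ℕ, ∀ n, n₀ ≤ n → ∃ c : ℂ, ∀ σ : Equiv.Perm (Fin n), (∀ i, σ i ≠ i) → (∀ m ∈ σ.cycleType, k < m) → Multiset.card σ.cycleType ≤ 2 → χ n σ = c * ((Equiv.Perm.sign σ : ℤ) : ℂ) := by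
  intro χ hχ hdc
  by_contra hnot
  push Not at hnot
  obtain ⟨c, hc⟩ := hdom χ hχ hdc hnot
  obtain ⟨m₀, hm₀⟩ := hhard c
  obtain ⟨m, hm, hle⟩ := hc m₀
  exact absurd (hm₀ m hm) (not_lt.2 hle)

/-- **Composition of the line**: `stub_sliceVBP → stub_dcTwoClassDominance → stub_dcPerHard_ae →
TwoClassRigidity` (piece 1 gives p-bounded `dc`; piece 2, assembled from stubs 2–3, gives
`c · sgn` on the `≤ 2`-cycle part of `Π_k(n)`; an `n`-cycle `σ` and a permutation `τ` of type
`(a, n - a)` with `k < a`, `k < n - a` lie there and `sgn τ = -sgn σ`, so `χ σ = -χ τ`).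
[folklore] -/
theorem TwoClassRigidity_of
    (h₁ : ∀ χ : (n : ℕ) → Equiv.Perm (Fin n) → ℂ, (∀ n (σ τ : Equiv.Perm (Fin n)), IsConj σ τ → χ n σ = χ n τ) → Literature.Computability.AlgebraicComplexity.IsVPFamily (fun n => ∑ σ : Equiv.Perm (Fin n), MvPolynomial.C (χ n σ) * ∏ i : Fin n, MvPolynomial.X (σ i, i)) → Literature.Computability.AlgebraicComplexity.IsPBounded (fun n => Literature.Computability.AlgebraicComplexity.determinantalComplexity (∑ σ : Equiv.Perm (Fin n), MvPolynomial.C (χ n σ) * ∏ i : Fin n, MvPolynomial.X (σ i, i))))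
    (hdom : ∀ χ : (n : ℕ) → Equiv.Perm (Fin n) → ℂ, (∀ n (σ τ : Equiv.Perm (Fin n)), IsConj σ τ → χ n σ = χ n τ) → Literature.Computability.AlgebraicComplexity.IsPBounded (fun n => Literature.Computability.AlgebraicComplexity.determinantalComplexity (∑ σ : Equiv.Perm (Fin n), MvPolynomial.C (χ n σ) * ∏ i : Fin n, MvPolynomial.X (σ i, i))) → (∀ k n₀ : ℕ, ∃ n, n₀ ≤ n ∧ ∀ c : ℂ, ∃ σ : Equiv.Perm (Fin n), (∀ i, σ i ≠ i) ∧ (∀ m ∈ σ.cycleType, k < m) ∧ Multiset.card σ.cycleType ≤ 2 ∧ χ n σ ≠ c * ((Equiv.Perm.sign σ : ℤ) : ℂ)) → ∃ c : ℕ, ∀ m₀ : ℕ, ∃ m, m₀ ≤ m ∧ Literature.Computability.AlgebraicComplexity.determinantalComplexity (Literature.Computability.AlgebraicComplexity.perPoly (Fin m) ℂ) ≤ m ^ c + c)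
    (hhard : ∀ c : ℕ, ∃ m₀ : ℕ, ∀ m, m₀ ≤ m → m ^ c + c < Literature.Computability.AlgebraicComplexity.determinantalComplexity (Literature.Computability.AlgebraicComplexity.perPoly (Fin m) ℂ)) :
    Summit.ValiantsHypothesis.ValiantsHypothesis.Theses.ImmanantSlice.TwoClassRigidity := by
  have h₂ := dcTwoClassRigidity_of_stubs hdom hhard
  intro χ hχ hVP
  obtain ⟨k, n₀, hk⟩ := h₂ χ hχ (h₁ χ hχ hVP)
  refine ⟨k, n₀, fun n hn a ha hna σ τ hσ hτ => ?_⟩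
  obtain ⟨c, hc⟩ := hk n hn
  obtain ⟨b, rfl⟩ : ∃ b, n = a + b := ⟨n - a, by omega⟩
  rw [Nat.add_sub_cancel_left] at hτ hna
  have hσfpf : ∀ i, σ i ≠ i := ne_self_of_sum_cycleType (by rw [hσ]; simp)
  have hτfpf : ∀ i, τ i ≠ i :=
    ne_self_of_sum_cycleType (by rw [hτ]; simp [Multiset.insert_eq_cons])
  have hσlong : ∀ m ∈ σ.cycleType, k < m := fun m hm => by
    rw [hσ, Multiset.mem_singleton] at hm; omega
  have hτlong : ∀ m ∈ τ.cycleType, k < m := fun m hm => by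
    rw [hτ] at hm
    simp only [Multiset.insert_eq_cons, Multiset.mem_cons, Multiset.mem_singleton] at hm
    rcases hm with rfl | rfl <;> omega
  have hσcard : Multiset.card σ.cycleType ≤ 2 := by rw [hσ]; simp
  have hτcard : Multiset.card τ.cycleType ≤ 2 := by rw [hτ]; simp
  have hsign := sign_eq_neg_sign_of_cycleType hσ hτ
  rw [hc σ hσfpf hσlong hσcard, hc τ hτfpf hτlong hτcard, hsign, Units.val_neg, Int.cast_neg,
    mul_neg, neg_neg]

/-- The line closes the crux BY NAME from the three stubs. [folklore] -/
theorem TwoClassRigidity_of_line :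
    Summit.ValiantsHypothesis.ValiantsHypothesis.Theses.ImmanantSlice.TwoClassRigidity :=
  TwoClassRigidity_of stub_sliceVBP stub_dcTwoClassDominance stub_dcPerHard_ae

end Summit.ValiantsHypothesis.ValiantsHypothesis.Cruxes.TwoClassRigidity.DcSplit
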